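import Summits.ValiantsHypothesis.ValiantsHypothesis.Theorems.KPlusLogSqLawTropicalBThresholdUniform

/-!
# Route «KPlusLogSqLaw», crux `TropicalB` (stmt-ValiantsHypothesis-19771) — NORMAL FORM: `TropicalB` ⟺ its restriction to DENSE
# boundary-type designs with at most `3(⌊log₂ m⌋ + 1)` boundaries

HONEST FRAMING.  Helper toward the registered stubs `stub_tropThin` / `stub_tropFat` of `Cruxes/TropicalB/Lines/birth.lean`
(crux `Summit.ValiantsHypothesis.ValiantsHypothesis.Theses.KPlusLogSqLaw.TropicalB`, item `stmt-ValiantsHypothesis-19771`, route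
`KPlusLogSqLaw`; cell `pub-symmetroid`, seat val-sym-trop-p1 g15, 2026-08-28; `--supports … --as helper`).  A NORMAL FORM of the crux
(an `↔`, like the tree's `tropicalB_iff_staticDiagonal` / `_iff_cardDominant` / `_iff_unsigned`), assembled from the threshold code
(`…TropicalBThresholdCodes.exists_injective_code`, p598988), the threshold embedding
(`…TropicalBThresholdNormalForm.card_dominant_le_of_code`, p599557) and the census plumbing of `…TropicalBThresholdUniform`
(p600310).  It asserts nothing about `TropicalB` itself and bears on neither `WeakLifting`, DoorA26 / DoorA34, `MatrixDescartes`
(stmt-ValiantsHypothesis-18050) nor VP ≠ VNP.  No definition is introduced.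

* `tropicalB_iff_logBoundaries` — **`TropicalB` holds iff ONE constant `C` bounds by `2^(C (K + ⌊log₂ m⌋²))` the number of dominant
  terms of every DENSE BOUNDARY-TYPE design (`BoundarySector.IsBoundaryDesign π ρ lab ε`, p447010: every entry present, carrying exactly the class
  `lab` of its pattern of order-comparison bits `[π_j a < ρ_j b]`) with `B ≤ 3(⌊log₂ m⌋ + 1)` boundaries.**  (⇒) is the vertex-count
  form of the crux (`tropicalB_iff_cardDominant`); (⇐) embeds every static design of size `2^L` into such a design with `3L` boundaries and one more
  class, passes to the static census rows (size padding), to the general rows (static ports at size `mK`, val-sym-trop-p4) and absorbs the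
  format change in the constant (`C ↦ C·(3A + 32)`, `A` the absolute constant of `exists_logsq_le_add`).
So the crux is a statement about `O(log m)` PAIRS OF ORDERS and a labelling of their `2^B` patterns — the permutation-register language of the
boundary sector — with no support or sparsity structure left.  [this cell]
-/

set_option linter.dupNamespace false
set_option autoImplicit false

namespace Summit.ValiantsHypothesis.ValiantsHypothesis.Theorems.KPlusLogSqLaw

namespace BoundarySector

open Summit.ValiantsHypothesis.ValiantsHypothesis.Theorems.MatrixDescartes.Negative
open Summit.ValiantsHypothesis.ValiantsHypothesis.Theorems.LacunarySymmetroidMatrixDescartes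
open Summit.ValiantsHypothesis.ValiantsHypothesis.Theorems.LacunarySymmetroidMatrixDescartes.TropicalCensus
open Summit.ValiantsHypothesis.ValiantsHypothesis.Theses.KPlusLogSqLaw (TropicalB)
open scoped BigOperators
open Finset

open scoped Classical in
/-- the static vertex count at size `2^L` from the log-boundary law. [this cell] -/
theorem card_dominant_static_le_of_logBoundaries {C : ℕ}
    (hC : ∀ (B n K' : ℕ) (π ρ : Fin B → Equiv.Perm (Fin n)) (lab : (Fin B → Bool) → Fin K') (d : Fin K' → ℕ)
      (v ε : Fin n → Fin n → Fin K' → ℤ), IsBoundaryDesign π ρ lab ε → B ≤ 3 * (Nat.log 2 n + 1) →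
      (univ.filter fun q : Equiv.Perm (Fin n) × (Fin n → Fin K') => ∃ t : ℤ, IsDominant d v ε t q).card ≤
        2 ^ (C * (K' + Nat.log 2 n ^ 2)))
    (L K : ℕ) (d : Fin K → ℕ) (v ε : Fin (2 ^ L) → Fin (2 ^ L) → Fin K → ℤ) (hstat : IsStatic ε) :
    (univ.filter fun q : Equiv.Perm (Fin (2 ^ L)) × (Fin (2 ^ L) → Fin K) => ∃ t : ℤ, IsDominant d v ε t q).card ≤
      2 ^ (C * (K + 1 + L ^ 2)) := by
  obtain ⟨π, ρ, hcode⟩ := exists_injective_code L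
  obtain ⟨lab, d', v', ε', hbd, -, hle⟩ := card_dominant_le_of_code π ρ hcode d v ε hstat
  have hlog : Nat.log 2 (2 ^ L) = L := Nat.log_pow one_lt_two L
  have hB : 3 * L ≤ 3 * (Nat.log 2 (2 ^ L) + 1) := by rw [hlog]; omega
  have h := hC _ _ _ π ρ lab d' v' ε' hbd hB
  rw [hlog] at h
  exact hle.trans h

open scoped Classical in
/-- the static census row at size `2^L` from the log-boundary law. [this cell] -/
theorem tropRootLawAtStatic_pow_of_logBoundaries {C : ℕ}
    (hC : ∀ (B n K' : ℕ) (π ρ : Fin B → Equiv.Perm (Fin n)) (lab : (Fin B → Bool) → Fin K') (d : Fin K' → ℕ)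
      (v ε : Fin n → Fin n → Fin K' → ℤ), IsBoundaryDesign π ρ lab ε → B ≤ 3 * (Nat.log 2 n + 1) →
      (univ.filter fun q : Equiv.Perm (Fin n) × (Fin n → Fin K') => ∃ t : ℤ, IsDominant d v ε t q).card ≤
        2 ^ (C * (K' + Nat.log 2 n ^ 2)))
    (L K : ℕ) : TropRootLawAtStatic (2 ^ L) K (2 ^ (C * (K + 1 + L ^ 2)) - 1) := by
  classical
  intro d v ε n θ p _ hstat hθ hdom halt
  have h1 := succ_le_card_dominant d v ε θ p hθ hdom (ne_succ_of_alternating ε p halt)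
  have h2 := card_dominant_static_le_of_logBoundaries hC L K d v ε hstat
  omega

open scoped Classical in
/-- the general census row from the log-boundary law (size padding to `2^(⌊log₂(mK)⌋+1)`, static ports at size `mK`). [this cell] -/
theorem tropRootLawAt_of_logBoundaries {C : ℕ}
    (hC : ∀ (B n K' : ℕ) (π ρ : Fin B → Equiv.Perm (Fin n)) (lab : (Fin B → Bool) → Fin K') (d : Fin K' → ℕ)
      (v ε : Fin n → Fin n → Fin K' → ℤ), IsBoundaryDesign π ρ lab ε → B ≤ 3 * (Nat.log 2 n + 1) →
      (univ.filter fun q : Equiv.Perm (Fin n) × (Fin n → Fin K') => ∃ t : ℤ, IsDominant d v ε t q).card ≤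
        2 ^ (C * (K' + Nat.log 2 n ^ 2)))
    (m K : ℕ) : TropRootLawAt m K (2 ^ (C * (K + 1 + (Nat.log 2 (m * K) + 1) ^ 2)) - 1) :=
  tropRootLawAt_of_static_ports_le le_rfl
    (tropRootLawAtStatic_of_le_size (Nat.lt_pow_succ_log_self one_lt_two (m * K)).le
      (tropRootLawAtStatic_pow_of_logBoundaries hC _ K))

open scoped Classical in
/-- **NORMAL FORM: `TropicalB` ⟺ the `K + log² m` law for DENSE BOUNDARY-TYPE designs with at most `3(⌊log₂ m⌋ + 1)` boundaries.**
[this cell] -/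
theorem tropicalB_iff_logBoundaries :
    TropicalB ↔ ∃ C : ℕ, ∀ (B m K : ℕ) (π ρ : Fin B → Equiv.Perm (Fin m)) (lab : (Fin B → Bool) → Fin K) (d : Fin K → ℕ)
      (v ε : Fin m → Fin m → Fin K → ℤ), IsBoundaryDesign π ρ lab ε → B ≤ 3 * (Nat.log 2 m + 1) →
      (Finset.univ.filter fun q : Equiv.Perm (Fin m) × (Fin m → Fin K) => ∃ t : ℤ, IsDominant d v ε t q).card ≤
        2 ^ (C * (K + Nat.log 2 m ^ 2)) := by
  classical
  constructor
  · intro hTB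
    obtain ⟨C, hC⟩ := tropicalB_iff_cardDominant.mp hTB
    exact ⟨C, fun B m K π ρ lab d v ε _ _ => hC m K d v ε⟩
  · rintro ⟨C, hC⟩
    obtain ⟨A, hA⟩ := exists_logsq_le_add
    refine ⟨C * (3 * A + 32), fun m K => ?_⟩
    show TropRootLawAt m K (2 ^ (C * (3 * A + 32) * (K + Nat.log 2 m ^ 2)))
    rcases Nat.eq_zero_or_pos K with rfl | hK
    · exact tropRootLawAt_zero m _
    refine tropRootLawAt_mono ?_ (tropRootLawAt_of_logBoundaries hC m K)
    refine (Nat.sub_le _ _).trans (Nat.pow_le_pow_right (by norm_num) ?_)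
    have h := logprod_le A hA m K hK
    have hsq : (Nat.log 2 (m * K) + 1) ^ 2 ≤ (Nat.log 2 (m * K) + 1) * (Nat.log 2 (m * K) + 2) := by
      rw [pow_two]; exact Nat.mul_le_mul_left _ (Nat.le_succ _)
    have e3 : 1 ≤ K + Nat.log 2 m ^ 2 := le_trans hK (Nat.le_add_right K _)
    have hK1 : K + 1 ≤ 2 * (K + Nat.log 2 m ^ 2) := by omega
    calc C * (K + 1 + (Nat.log 2 (m * K) + 1) ^ 2)
        ≤ C * (2 * (K + Nat.log 2 m ^ 2) + (3 * A + 30) * (K + Nat.log 2 m ^ 2)) :=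
          Nat.mul_le_mul_left _ (Nat.add_le_add hK1 (hsq.trans h))
      _ = C * (3 * A + 32) * (K + Nat.log 2 m ^ 2) := by ring

end BoundarySector

end Summit.ValiantsHypothesis.ValiantsHypothesis.Theorems.KPlusLogSqLaw
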